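import Summits.FinalStateConjecture.FinalStateConjecture.Theses.LaminatedThreshold
import Literature.Geometry.Lorentzian.VisibleIncompleteNullRay

/-!
# Crux `LaminatedThreshold` — line `birth`: BIRTH SKELETON (BC3; skeleton registrar, 2026-08-17)

Crux item `stmt-FinalStateConjecture-16893`, decl (FIXED, concluded BY NAME in `LaminatedThreshold_of`):
`Summit.FinalStateConjecture.FinalStateConjecture.Theses.LaminatedThreshold.LaminatedThreshold`
(REFUTATION route `route-FinalStateConjecture-LaminatedThreshold`, crux A, rank 2; `closes :
LaminatedThreshold → TameExitsLocalise → ¬ FinalStateConjecture`) — at some admissible exceptional datum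
`d⋆` there are a real functional `Φ` on data and `K ∋ Φ d⋆`, `Φ d⋆` a TWO-SIDED accumulation point of
`K`, such that along every jointly smooth admissible family through `d⋆` supported in one compact set
`Φ` is continuous near the base and every member with `Φ`-value in `K` is EXCEPTIONAL (not good in the
re-typed sense: MGHD exists ∧ every MGHD has complete sojourn-`𝓘⁺` and a sub-extremal, ray-closed,
exhaustive, future-oriented Kerr decomposition).

## The cut (the route's own TWO-LAYER PLAN for this crux, typed over existing declarations only)

The plan reads `LaminatedThreshold ⇐ ChaoticThresholdSaddle → StableLeavesLaminate →
ThresholdLeavesAreNaked`: a chaotic saddle on the vacuum collapse threshold laminates the exceptional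
set near `d⋆` by leaves of ETERNALLY CRITICAL data, and such data are exceptional BECAUSE THEY FORM NAKED
SINGULARITIES ("some MGHD has a zero-mass first singular point whose Cauchy horizon reaches arbitrarily
large radii"). The dynamical carrier (renormalised flow, hyperbolic set) has no typed notion, but the
MECHANISM OF EXCEPTIONALITY does: a **visible future-incomplete null ray** of a Cauchy development
(`DataEmbedding.IsVisibleIncompleteNullRay`, `VisibleIncompleteNullRay.lean`: a maximal null geodesic,
future incomplete, every late event in `I⁻` of the far part of a future-COMPLETE normalised null ray
from the data — Hawking–Ellis' "naked, i.e. visible from `𝓘⁺`", inlined verbatim as in the items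
`NoFourthExit` / `VisibleIncompleteRay` of route `CurvatureOrSymmetry`). The honest two pieces are
therefore the two things the plan actually claims:

* `stub_laminatedNakedThreshold` — THE LAMINATED NAKED THRESHOLD (dynamics; `ChaoticThresholdSaddle` +
  `StableLeavesLaminate` + the nakedness half of `ThresholdLeavesAreNaked`): there are `X`, an admissible
  `d⋆`, `Φ`, `K ∋ Φ d⋆` two-sidedly accumulating at `Φ d⋆`, such that along every jointly smooth
  admissible compactly supported family `F` through `d⋆`: `Φ ∘ F` is continuous on a `δ`-ball and every
  member there with `Φ(F c) ∈ K` is NAKED — EVERY maximal vacuum Cauchy development of `F c` carries a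
  visible future-incomplete null ray. No word about `𝓘⁺`, charts or Kerr. [open-problem]
* `stub_nakedNotSettled` — NAKED DEVELOPMENTS ARE EXCEPTIONAL FOR THE FINAL-STATE PROPERTY (global
  Lorentzian geometry; the other half of `ThresholdLeavesAreNaked`): a maximal vacuum Cauchy development
  of an admissible datum carrying a visible future-incomplete null ray does NOT both have complete `𝓘⁺`
  (sojourn form) and settle down (sub-extremal `FinalStateDecomposition` of `O = exteriorOf`,
  `RaysStayInClosure`, `HasExhaustiveCharts`, `IsFutureOriented`). Two independent proof avenues: (A) a
  singularity visible from complete rays cuts the MGHD's null infinity short (Hawking–Ellis Prop. 9.2.1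
  read intrinsically; the converse of item `VisibleIncompleteRay`); (B) a settled, exhaustively charted,
  future-oriented exterior is future null geodesically complete off the horizons, and rays in
  `I⁻`(complete rays) ⊆ `closure O` never cross them. [L–XL]

Composition `LaminatedThreshold_of` (kernel-checked, no `sorry` of its own): from Stub 1 take
`X, d⋆, Φ, K`; Stub 2 turns "naked" into "exceptional" at every admissible datum of `X` (`key`); the
conjunct "`d⋆` is exceptional" of the crux is NOT assumed — it is READ OFF the saturation clause along the
CONSTANT family (`InitialDataSet.isSmoothDataFamily_const`, empty compact set, `Φ d⋆ ∈ K`); the family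
clause of the crux is Stub 1's clause pushed through `key`. Neither stub alone is the crux: Stub 1 never
mentions the final-state property (crux ↛ Stub 1 either: exceptional ⇏ naked), Stub 2 is a universal
statement producing no datum.

## BC3 probes (seat folder `bc/LaminatedThreshold_probes*.lean`; they import the ROUTE FILE only — not this
## skeleton — so no sorried theorem concluding the crux is in scope for `exact?`): see `Lines/birth.md`.

## Disproof used
None relevant: the crux has no `Disproof.lean` / Negative lemmas (`ledger crux ls`: no workfiles before this
one); `ledger negatives --problem FinalStateConjecture`: one unrelated refutation
(`not_UniformPhotonSphereChannels`). Neither stub is an instance of it.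
-/

noncomputable section

-- the doubled `FinalStateConjecture.FinalStateConjecture` path component trips dupNamespace
set_option linter.dupNamespace false

namespace Summit.FinalStateConjecture.FinalStateConjecture.Cruxes.LaminatedThreshold.Birth

open Set Filter Function Topology TopologicalSpace
open scoped Manifold ContDiff
open Literature.Geometry.Lorentzian
open Summit.FinalStateConjecture.FinalStateConjecture.Theses.LaminatedThreshold

/-! ## §0 Vocabulary of the proof (NOT used inside stub signatures, which are fully expanded) -/

section Vocabulary

variable {X : Type} [TopologicalSpace X] [ChartedSpace E3 X] [IsManifold (𝓡 3) ∞ X] [T2Space X]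
  [SecondCountableTopology X] [ConnectedSpace X]

/-- **Good in the re-typed sense** (verbatim the summit's property at a datum `D`): an MGHD exists, and
every MGHD has complete `𝓘⁺` and settles down. [cite: DafermosLuk2017, Conjecture 1] -/
def IsGood (D : InitialDataSet (𝓡 3) X) : Prop :=
  (∃ 𝒟 : Literature.Geometry.Lorentzian.VacuumCauchyDevelopment D, 𝒟.IsMaximal) ∧ ∀ 𝒟 : Literature.Geometry.Lorentzian.VacuumCauchyDevelopment D, 𝒟.IsMaximal → Summit.FinalStateConjecture.HasCompleteNullInfinity 𝒟.toCauchyDevelopment ∧ ∃ (O : Set 𝒟.carrier) (d : Literature.Geometry.Lorentzian.FinalStateDecomposition 𝒟.toSpacetime O 2), (∀ i, Literature.Geometry.Lorentzian.Kerr.IsSubextremal (d.mass i) (d.spin i)) ∧ O = Summit.FinalStateConjecture.exteriorOf 𝒟.toCauchyDevelopment d.charted ∧ Summit.FinalStateConjecture.RaysStayInClosure 𝒟.toCauchyDevelopment O ∧ Summit.FinalStateConjecture.HasExhaustiveCharts d ∧ Summit.FinalStateConjecture.IsFutureOriented d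

/-- **`𝒟` carries a visible future-incomplete null ray** (verbatim the predicate inlined in
`CurvatureOrSymmetry.VisibleIncompleteRay`; `= ∀ [LC], ∃ γ dom, 𝒟.IsVisibleIncompleteNullRay γ dom`,
lemma `hasNakedRay_iff`). [cite: HawkingEllis1973CUP, §9.2, p. 311] -/
def HasNakedRay {D : InitialDataSet (𝓡 3) X} (𝒟 : Literature.Geometry.Lorentzian.VacuumCauchyDevelopment D) : Prop :=
  ∀ [𝒟.metric.HasLeviCivita], ∃ (γ : ℝ → 𝒟.carrier) (dom : Set ℝ), (Literature.Geometry.Lorentzian.IsMaximalGeodesicOn 𝒟.metric.leviCivita γ dom ∧ (0 : ℝ) ∈ dom ∧ BddAbove dom ∧ (∀ t ∈ dom, 𝒟.metric.IsNull (Literature.Geometry.Lorentzian.velocity (𝓡 4) γ t) ∧ 𝒟.timeOrientation.IsFutureDirected (Literature.Geometry.Lorentzian.velocity (𝓡 4) γ t)) ∧ (∀ t ∈ dom, 0 ≤ t → (∃ (p : X) (δ : ℝ → 𝒟.carrier) (s : Set ℝ), 𝒟.metric.IsNormalisedNullRayFrom 𝒟.timeOrientation 𝒟.embed 𝒟.normal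 p δ s ∧ ¬ BddAbove s ∧ γ t ∈ 𝒟.metric.chronologicalPast 𝒟.timeOrientation (δ '' (s ∩ Set.Ici 0)))))

/-- **Naked datum**: every maximal vacuum Cauchy development of `D` carries a visible future-incomplete
null ray (MGHDs are unique up to isometry; "every" keeps the notion free of an existence claim). -/
def IsNakedDatum (D : InitialDataSet (𝓡 3) X) : Prop :=
  ∀ 𝒟 : Literature.Geometry.Lorentzian.VacuumCauchyDevelopment D, 𝒟.IsMaximal → HasNakedRay 𝒟

omit [T2Space X] [SecondCountableTopology X] in
/-- Sanity (no sorry): the inlined predicate IS the packaged `DataEmbedding.IsVisibleIncompleteNullRay`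
of `VisibleIncompleteNullRay.lean`. [folklore] -/
theorem hasNakedRay_iff {D : InitialDataSet (𝓡 3) X} (𝒟 : Literature.Geometry.Lorentzian.VacuumCauchyDevelopment D) :
    HasNakedRay 𝒟 ↔ ∀ [𝒟.metric.HasLeviCivita], ∃ (γ : ℝ → 𝒟.carrier) (dom : Set ℝ),
      𝒟.toDataEmbedding.IsVisibleIncompleteNullRay γ dom :=
  Iff.rfl

end Vocabulary

/-! ## §1 The two statements of the line (named; nothing here is a route item) -/

/-- **THE LAMINATED NAKED THRESHOLD** (`stub_laminatedNakedThreshold`; dynamics): there are a connected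
Hausdorff second-countable smooth `3`-manifold `X`, an admissible vacuum datum `d⋆` on it, a functional
`Φ` on initial data sets and `K ⊆ ℝ` with `Φ d⋆ ∈ K` a TWO-SIDED accumulation point of `K`, such that for
every jointly smooth one-parameter family `F` through `d⋆` with admissible members agreeing with `d⋆`
outside one compact set there is `δ > 0` with `c ↦ Φ(F c)` continuous on the `δ`-ball and, for
`‖c‖ < δ`, `Φ(F c) ∈ K ⇒` every maximal vacuum Cauchy development of `F c` carries a VISIBLE
FUTURE-INCOMPLETE NULL RAY (a naked singularity in Hawking–Ellis' sense: maximal null geodesic with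
affine domain bounded above, future-directed, each of its events from parameter `0` on lying in the
chronological past of the far part of a future-complete normalised null ray from the data). Intended
mechanism: an index-`1` hyperbolic basic set `Λ` of the renormalised vacuum flow at the black-hole
threshold (BaumgarteEtAl2023: no universal critical solution, bifurcating collapse centre) whose stable
lamination `W^s(Λ)` is locally Cantor × codimension-one leaf with transversal coordinate `Φ`
(BatesLuZeng1998), each leaf consisting of eternally critical data whose first singular point is massless
and visible (GrebogiEtAl1983 / McdonaldEtAl1985: final-state sensitivity). The degenerate case `Φ` constant,
`K = ℝ` (a STABLE naked singularity under compactly supported perturbations) is included. Why it might fail: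
vacuum thresholds may be locally finite unions of `C¹` sheets (hyperbolic DSS critical solutions ⇒ embedded
stable manifolds) as in every spherical model (Christodoulou Ann. Math. 149, Thm 4.1: barrier
`nakedSingularityInstability`), and no smooth one-ended admissible datum is presently KNOWN to be naked
(Rodnianski–Shlapentokh-Rothman's vacuum naked singularities have limited regularity).
[cite: BaumgarteEtAl2023] [cite: SzybkaChmaj2008] [cite: HawkingEllis1973CUP, §9.2, p. 311] -/
def LaminatedNakedThreshold : Prop :=
  ∃ (X : Type) (_ : TopologicalSpace X) (_ : ChartedSpace Literature.Geometry.Lorentzian.E3 X) (_ : IsManifold (𝓡 3) ((⊤ : ℕ∞) : WithTop ℕ∞) X) (_ : T2Space X) (_ : SecondCountableTopology X) (_ : ConnectedSpace X) (dstar : Literature.Geometry.Lorentzian.InitialDataSet (𝓡 3) X) (Φ : Literature.Geometry.Lorentzian.InitialDataSet (𝓡 3) X → ℝ) (K : Set ℝ), dstar ∈ Literature.Geometry.Lorentzian.admissibleVacuumData X ∧ Φ dstar ∈ K ∧ (∀ ε : ℝ, 0 < ε → (K ∩ Set.Ioo (Φ dstar - ε) (Φ dstar)).Nonempty ∧ (K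 ∩ Set.Ioo (Φ dstar) (Φ dstar + ε)).Nonempty) ∧ ∀ F : EuclideanSpace ℝ (Fin 1) → Literature.Geometry.Lorentzian.InitialDataSet (𝓡 3) X, Literature.Geometry.Lorentzian.InitialDataSet.IsSmoothDataFamily 1 F → F 0 = dstar → (∀ c, F c ∈ Literature.Geometry.Lorentzian.admissibleVacuumData X) → (∃ C : Set X, IsCompact C ∧ ∀ c, ∀ x ∉ C, (F c).h.inner x = dstar.h.inner x ∧ (F c).k x = dstar.k x) → ∃ δ : ℝ, 0 < δ ∧ ContinuousOn (fun c ↦ Φ (F c)) (Metric.ball 0 δ) ∧ ∀ c ∈ Metric.ball (0 : EuclideanSpace ℝ (Fin 1)) δ, Φ (F c) ∈ K → ∀ 𝒟 : Literature.Geometry.Lorentzian.VacuumCauchyDevelopment (F c), 𝒟.IsMaximal → ∀ [𝒟.metric.HasLeviCivita], ∃ (γ : ℝ → 𝒟.carrier) (dom : Set ℝ), (Literature.Geometry.Lorentzian.IsMaximalGeodesicOn 𝒟.metric.leviCivita γ dom ∧ (0 : ℝ) ∈ dom ∧ BddAbove dom ∧ (∀ t ∈ dom, 𝒟.metric.IsNull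 (Literature.Geometry.Lorentzian.velocity (𝓡 4) γ t) ∧ 𝒟.timeOrientation.IsFutureDirected (Literature.Geometry.Lorentzian.velocity (𝓡 4) γ t)) ∧ (∀ t ∈ dom, 0 ≤ t → (∃ (p : X) (δ' : ℝ → 𝒟.carrier) (s : Set ℝ), 𝒟.metric.IsNormalisedNullRayFrom 𝒟.timeOrientation 𝒟.embed 𝒟.normal p δ' s ∧ ¬ BddAbove s ∧ γ t ∈ 𝒟.metric.chronologicalPast 𝒟.timeOrientation (δ' '' (s ∩ Set.Ici 0)))))

/-- **NAKED DEVELOPMENTS ARE EXCEPTIONAL FOR THE FINAL-STATE PROPERTY** (`stub_nakedNotSettled`; global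
Lorentzian geometry): for every `X` as above, every admissible vacuum datum `D` on `X` and every MAXIMAL
vacuum Cauchy development `𝒟` of `D` carrying a visible future-incomplete null ray, it is NOT the case
that `𝒟` both has complete future null infinity (sojourn form, `HasCompleteNullInfinity`) and settles
down in the summit's sense (a `C²` sub-extremal `FinalStateDecomposition d` of `O = exteriorOf 𝒟
d.charted` with `RaysStayInClosure 𝒟 O`, `HasExhaustiveCharts d`, `IsFutureOriented d`). Why plausibly
true: (A) an incomplete null geodesic all of whose late events are seen from future-complete rays is a
singularity visible from `𝓘⁺`; for a globally hyperbolic development this cuts `𝓘⁺` short — ingoing rays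
from far out meet the Cauchy horizon of the first singular point after a sojourn in `J⁺(ι B₀)` bounded
independently of their starting radius (Hawking–Ellis 1973 Prop. 9.2.1; Dafermos CQG 22 (2005) §1; the
test table of `NullInfinity.lean`; the converse direction is item `VisibleIncompleteRay` of route
`CurvatureOrSymmetry`); (B) independently, a settled exterior whose charts EXHAUST `O` with chart time
future-oriented and `C²`-deviation from Kerr–Schild / Minkowski tending to `0` is future null geodesically
complete away from the event horizons, while a visible ray stays in `I⁻`(complete rays) `⊆ closure O`
(`RaysStayInClosure`) and never crosses them. Why it might fail: `C²` convergence on slabs carries NO RATE,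
so (B) needs the vacuum equations (a conspiring non-vacuum metric with deviation `∼ 1/τ` has null geodesics
reaching `x⁰ = ∞` at finite affine parameter); the sojourn form constrains only rays starting outside
growing compacta `B₁(s)`, so (A) needs the domain-of-dependence geometry of the admissible (asymptotically
flat, one-ended) class; typed visibility uses complete rays that need not reach infinity (horizon
generators, trapped photon orbits — harmless, their pasts are exterior — but an exotic complete ray inside
a non-Kerr black-hole interior would make interior singular rays "visible"). Size L–XL.
[cite: HawkingEllis1973CUP, §9.2, Prop. 9.2.1] [cite: DafermosLuk2017, Conjecture 1] [cite: arXiv08110354, §2.6.2] -/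
def NakedNotSettled : Prop :=
  ∀ (X : Type) [TopologicalSpace X] [ChartedSpace Literature.Geometry.Lorentzian.E3 X] [IsManifold (𝓡 3) ((⊤ : ℕ∞) : WithTop ℕ∞) X] [T2Space X] [SecondCountableTopology X] [ConnectedSpace X], ∀ D ∈ Literature.Geometry.Lorentzian.admissibleVacuumData X, ∀ 𝒟 : Literature.Geometry.Lorentzian.VacuumCauchyDevelopment D, 𝒟.IsMaximal → (∀ [𝒟.metric.HasLeviCivita], ∃ (γ : ℝ → 𝒟.carrier) (dom : Set ℝ), (Literature.Geometry.Lorentzian.IsMaximalGeodesicOn 𝒟.metric.leviCivita γ dom ∧ (0 : ℝ) ∈ dom ∧ BddAbove dom ∧ (∀ t ∈ dom, 𝒟.metric.IsNull (Literature.Geometry.Lorentzian.velocity (𝓡 4) γ t) ∧ 𝒟.timeOrientation.IsFutureDirected (Literature.Geometry.Lorentzian.velocity (𝓡 4) γ t)) ∧ (∀ t ∈ dom, 0 ≤ t → (∃ (p : X) (δ' : ℝ → 𝒟.carrier) (s : Set ℝ), 𝒟.metric.IsNormalisedNullRayFrom 𝒟.timeOrientation 𝒟.embed 𝒟.normal p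 δ' s ∧ ¬ BddAbove s ∧ γ t ∈ 𝒟.metric.chronologicalPast 𝒟.timeOrientation (δ' '' (s ∩ Set.Ici 0)))))) → ¬ (Summit.FinalStateConjecture.HasCompleteNullInfinity 𝒟.toCauchyDevelopment ∧ ∃ (O : Set 𝒟.carrier) (d : Literature.Geometry.Lorentzian.FinalStateDecomposition 𝒟.toSpacetime O 2), (∀ i, Literature.Geometry.Lorentzian.Kerr.IsSubextremal (d.mass i) (d.spin i)) ∧ O = Summit.FinalStateConjecture.exteriorOf 𝒟.toCauchyDevelopment d.charted ∧ Summit.FinalStateConjecture.RaysStayInClosure 𝒟.toCauchyDevelopment O ∧ Summit.FinalStateConjecture.HasExhaustiveCharts d ∧ Summit.FinalStateConjecture.IsFutureOriented d)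

/-! ### Statements of the registered stubs, under the stub names
The skeleton audit reads the hypotheses of `LaminatedThreshold_of` BY NAME: each head is a declared stub. -/
namespace Goal

/-- Statement of `stub_laminatedNakedThreshold`. -/
abbrev stub_laminatedNakedThreshold : Prop := LaminatedNakedThreshold
/-- Statement of `stub_nakedNotSettled`. -/
abbrev stub_nakedNotSettled : Prop := NakedNotSettled

end Goal

/-! ## §2 Registered stubs (the two `sorry`s of the file), stated EXPANDED over existing declarations
(Statement + Literature prelude only; no vocabulary of this file occurs in a stub signature). -/

/-- **Stub 1** (open-problem): the laminated naked threshold — see `LaminatedNakedThreshold`.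
[cite: BaumgarteEtAl2023] [cite: HawkingEllis1973CUP, §9.2, p. 311] -/
theorem stub_laminatedNakedThreshold :
    ∃ (X : Type) (_ : TopologicalSpace X) (_ : ChartedSpace Literature.Geometry.Lorentzian.E3 X) (_ : IsManifold (𝓡 3) ((⊤ : ℕ∞) : WithTop ℕ∞) X) (_ : T2Space X) (_ : SecondCountableTopology X) (_ : ConnectedSpace X) (dstar : Literature.Geometry.Lorentzian.InitialDataSet (𝓡 3) X) (Φ : Literature.Geometry.Lorentzian.InitialDataSet (𝓡 3) X → ℝ) (K : Set ℝ), dstar ∈ Literature.Geometry.Lorentzian.admissibleVacuumData X ∧ Φ dstar ∈ K ∧ (∀ ε : ℝ, 0 < ε → (K ∩ Set.Ioo (Φ dstar - ε) (Φ dstar)).Nonempty ∧ (K ∩ Set.Ioo (Φ dstar) (Φ dstar + ε)).Nonempty) ∧ ∀ F : EuclideanSpace ℝ (Fin 1) → Literature.Geometry.Lorentzian.InitialDataSet (𝓡 3) X, Literature.Geometry.Lorentzian.InitialDataSet.IsSmoothDataFamily 1 F → F 0 = dstar → (∀ c, F c ∈ Literature.Geometry.Lorentzian.admissibleVacuumData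 X) → (∃ C : Set X, IsCompact C ∧ ∀ c, ∀ x ∉ C, (F c).h.inner x = dstar.h.inner x ∧ (F c).k x = dstar.k x) → ∃ δ : ℝ, 0 < δ ∧ ContinuousOn (fun c ↦ Φ (F c)) (Metric.ball 0 δ) ∧ ∀ c ∈ Metric.ball (0 : EuclideanSpace ℝ (Fin 1)) δ, Φ (F c) ∈ K → ∀ 𝒟 : Literature.Geometry.Lorentzian.VacuumCauchyDevelopment (F c), 𝒟.IsMaximal → ∀ [𝒟.metric.HasLeviCivita], ∃ (γ : ℝ → 𝒟.carrier) (dom : Set ℝ), (Literature.Geometry.Lorentzian.IsMaximalGeodesicOn 𝒟.metric.leviCivita γ dom ∧ (0 : ℝ) ∈ dom ∧ BddAbove dom ∧ (∀ t ∈ dom, 𝒟.metric.IsNull (Literature.Geometry.Lorentzian.velocity (𝓡 4) γ t) ∧ 𝒟.timeOrientation.IsFutureDirected (Literature.Geometry.Lorentzian.velocity (𝓡 4) γ t)) ∧ (∀ t ∈ dom, 0 ≤ t → (∃ (p : X) (δ' : ℝ → 𝒟.carrier) (s : Set ℝ), 𝒟.metric.IsNormalisedNullRayFrom 𝒟.timeOrientation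 𝒟.embed 𝒟.normal p δ' s ∧ ¬ BddAbove s ∧ γ t ∈ 𝒟.metric.chronologicalPast 𝒟.timeOrientation (δ' '' (s ∩ Set.Ici 0))))) := by
  sorry

/-- **Stub 2** (L–XL): naked developments are exceptional for the final-state property — see
`NakedNotSettled`. [cite: HawkingEllis1973CUP, §9.2, Prop. 9.2.1] [cite: DafermosLuk2017, Conjecture 1] -/
theorem stub_nakedNotSettled :
    ∀ (X : Type) [TopologicalSpace X] [ChartedSpace Literature.Geometry.Lorentzian.E3 X] [IsManifold (𝓡 3) ((⊤ : ℕ∞) : WithTop ℕ∞) X] [T2Space X] [SecondCountableTopology X] [ConnectedSpace X], ∀ D ∈ Literature.Geometry.Lorentzian.admissibleVacuumData X, ∀ 𝒟 : Literature.Geometry.Lorentzian.VacuumCauchyDevelopment D, 𝒟.IsMaximal → (∀ [𝒟.metric.HasLeviCivita], ∃ (γ : ℝ → 𝒟.carrier) (dom : Set ℝ), (Literature.Geometry.Lorentzian.IsMaximalGeodesicOn 𝒟.metric.leviCivita γ dom ∧ (0 : ℝ) ∈ dom ∧ BddAbove dom ∧ (∀ t ∈ dom, 𝒟.metric.IsNull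 (Literature.Geometry.Lorentzian.velocity (𝓡 4) γ t) ∧ 𝒟.timeOrientation.IsFutureDirected (Literature.Geometry.Lorentzian.velocity (𝓡 4) γ t)) ∧ (∀ t ∈ dom, 0 ≤ t → (∃ (p : X) (δ' : ℝ → 𝒟.carrier) (s : Set ℝ), 𝒟.metric.IsNormalisedNullRayFrom 𝒟.timeOrientation 𝒟.embed 𝒟.normal p δ' s ∧ ¬ BddAbove s ∧ γ t ∈ 𝒟.metric.chronologicalPast 𝒟.timeOrientation (δ' '' (s ∩ Set.Ici 0)))))) → ¬ (Summit.FinalStateConjecture.HasCompleteNullInfinity 𝒟.toCauchyDevelopment ∧ ∃ (O : Set 𝒟.carrier) (d : Literature.Geometry.Lorentzian.FinalStateDecomposition 𝒟.toSpacetime O 2), (∀ i, Literature.Geometry.Lorentzian.Kerr.IsSubextremal (d.mass i) (d.spin i)) ∧ O = Summit.FinalStateConjecture.exteriorOf 𝒟.toCauchyDevelopment d.charted ∧ Summit.FinalStateConjecture.RaysStayInClosure 𝒟.toCauchyDevelopment O ∧ Summit.FinalStateConjecture.HasExhaustiveCharts d ∧ Summit.FinalStateConjecture.IsFutureOriented d)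 := by
  sorry

/-! ## §3 The composition (kernel-checked; no `sorry` of its own) -/

section Composition

variable {X : Type} [TopologicalSpace X] [ChartedSpace E3 X] [IsManifold (𝓡 3) ∞ X] [T2Space X]
  [SecondCountableTopology X] [ConnectedSpace X]

/-- The key conversion: under Stub 2, a NAKED admissible datum is EXCEPTIONAL (not good). [folklore] -/
theorem not_isGood_of_isNakedDatum (hN : NakedNotSettled) {D : InitialDataSet (𝓡 3) X}
    (hD : D ∈ admissibleVacuumData X) (hnaked : IsNakedDatum D) : ¬ IsGood D := by
  rintro ⟨⟨𝒟, h𝒟⟩, hall⟩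
  exact hN X D hD 𝒟 h𝒟 (hnaked 𝒟 h𝒟) (hall 𝒟 h𝒟)

end Composition

/-- **THE CRUX BY NAME** from the two registered stubs. From Stub 1 take `X, d⋆, Φ, K`; Stub 2 makes
every naked admissible datum of `X` exceptional (`not_isGood_of_isNakedDatum`); the crux's conjunct
"`d⋆` is exceptional" is obtained from the saturation clause along the CONSTANT family through `d⋆`
(`InitialDataSet.isSmoothDataFamily_const`; it agrees with `d⋆` off the empty compact set and
`Φ d⋆ ∈ K`); the family clause is Stub 1's, pushed through the conversion. [folklore] -/
theorem LaminatedThreshold_of :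
    Goal.stub_laminatedNakedThreshold → Goal.stub_nakedNotSettled → LaminatedThreshold := by
  intro hA hN
  obtain ⟨X, i₁, i₂, i₃, i₄, i₅, i₆, dstar, Φ, K, hadm, hK, hacc, hsat⟩ := hA
  -- naked ⇒ exceptional at every admissible datum of `X`
  have key : ∀ D ∈ admissibleVacuumData X, IsNakedDatum D → ¬ IsGood D :=
    fun D hD hnaked ↦ not_isGood_of_isNakedDatum hN hD hnaked
  refine ⟨X, i₁, i₂, i₃, i₄, i₅, i₆, dstar, Φ, K, hadm, ?_, hK, hacc, ?_⟩
  · -- `d⋆` is exceptional: saturation along the constant family through `d⋆`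
    obtain ⟨δ, hδ, -, hnaked⟩ := hsat (fun _ ↦ dstar) (InitialDataSet.isSmoothDataFamily_const 1 dstar)
      rfl (fun _ ↦ hadm) ⟨∅, isCompact_empty, fun _ _ _ ↦ ⟨rfl, rfl⟩⟩
    exact key dstar hadm (hnaked 0 (Metric.mem_ball_self hδ) hK)
  · -- the family clause: Stub 1's clause, nakedness converted into exceptionality
    intro F hF h0 hFadm hC
    obtain ⟨δ, hδ, hcont, hnaked⟩ := hsat F hF h0 hFadm hC
    exact ⟨δ, hδ, hcont, fun c hc hcK ↦ key (F c) (hFadm c) (hnaked c hc hcK)⟩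

/-! ### Consistency: each registered stub, stated EXPANDED, IS the named statement of §1. -/

theorem laminatedNakedThreshold_holds : LaminatedNakedThreshold := stub_laminatedNakedThreshold
theorem nakedNotSettled_holds : NakedNotSettled := stub_nakedNotSettled

/-- **The crux from the skeleton** (closed modulo the two `sorry`s). [folklore] -/
theorem LaminatedThreshold_proof : LaminatedThreshold :=
  LaminatedThreshold_of stub_laminatedNakedThreshold stub_nakedNotSettled

/-! ### Sanity (no `sorry`): what the crux gives back.
The crux implies NEITHER stub (Stub 1 asserts a sharper mechanism than "exceptional", Stub 2 is a
universal consistency statement) — but together with Stub 2's CONVERSE-TYPE reading one recovers the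
purely logical skeleton of `closes`: an exceptional datum with `Φ`-saturation. Recorded here: the crux
yields a datum that is admissible and not good, by name. -/

/-- The crux exhibits an admissible exceptional datum (its first two conjuncts, in the vocabulary of
§0). [folklore] -/
theorem exists_not_isGood_of_crux (h : LaminatedThreshold) :
    ∃ (X : Type) (_ : TopologicalSpace X) (_ : ChartedSpace E3 X) (_ : IsManifold (𝓡 3) ∞ X)
      (_ : T2Space X) (_ : SecondCountableTopology X) (_ : ConnectedSpace X)
      (dstar : InitialDataSet (𝓡 3) X), dstar ∈ admissibleVacuumData X ∧ ¬ IsGood dstar := by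
  obtain ⟨X, i₁, i₂, i₃, i₄, i₅, i₆, dstar, Φ, K, hD, hbad, -⟩ := h
  exact ⟨X, i₁, i₂, i₃, i₄, i₅, i₆, dstar, hD, hbad⟩

end Summit.FinalStateConjecture.FinalStateConjecture.Cruxes.LaminatedThreshold.Birth

end
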